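import Literature.Geometry.Kaehler.ComplexTorusPicardNumberThirdGap
import HarnessLib

/-!
# Hulek–Laface 2019, Thm. 7.4 (gap form) for EVERY `ℓ`: the inductive step made explicit

[cite: HulekLaface2019PicardNumbersAV, §7.2 Thm. 7.4 (proof)]: "Let us start with a pair `(ℓ, g_ℓ)` such
that the following holds: there is no abelian variety of dimension `g ≥ g_ℓ` and Picard number `ρ` such
that `(g−t)² + t² < ρ < (g−t+1)² + 1` for `2 ≤ t ≤ ℓ` or `(g−1)² + 1 < ρ < g²`.  Then, the claim is
that we can find `g_{ℓ+1} ≥ g_ℓ` such that there is no abelian variety of dimension `g ≥ g_{ℓ+1}` and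
Picard number `ρ` such that `[g−(ℓ+1)]² + (ℓ+1)² < ρ < (g−ℓ)² + 1`. […] let `Y` be an abelian variety
that contradicts the statement we want to prove.  Then `Y ∼ A_n × A_{g−n}`, where `n ≤ g−n` and
`Hom(A_n, A_{g−n}) = 0`.  It is straightforward to see that `n ≤ ℓ`, as `ρ(Y) > [g−(ℓ+1)]² + (ℓ+1)²`.
By additivity of the Picard number `ρ(Y) = ρ_n + ρ_{g−n}` […]
`[(g−n)−(ℓ−n+1)]² + (ℓ−n+1)² < ρ(A_{g−n}) < [(g−n)−(ℓ−n)]² + 1`, which contradicts the `(ℓ−n+1)`-st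
condition above."

This file proves the inductive step for the sets `R_g = picardNumbers g` with EXPLICIT genera
(`picardNumbers_gap_step`: the `(ℓ+1)`-st gap holds in every dimension `g ≥ max(2 g_ℓ, 3ℓ + 4)` once the
gaps `2 ≤ t ≤ ℓ` hold in dimensions `≥ g_ℓ ≥ 4`), and hence **Thm. 7.4 in gap form for every `ℓ`**
(`picardNumbers_gaps`: for every `ℓ` there is `g_ℓ` with no Picard number of a `g`-dimensional abelian
variety, `g ≥ g_ℓ`, in any of the windows `((g−t)² + t², (g−t+1)² + 1)`, `2 ≤ t ≤ ℓ`; the window `t = 1`,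
`((g−1)² + 1, g²)`, is Thm. 1.1 (1) for `g ≥ 4`), together with the version for abelian varieties on
arbitrary period models (`IsAbelianVariety.exists_genus_not_gap`).  The explicit genera `g₂ = 7`,
`g₃ = 9`, `g₄`-free of `ComplexTorusPicardNumberGapsGeneral.lean` / `ComplexTorusPicardNumberThirdGap.lean`
are sharper than the recursion `g_{ℓ+1} = max(2 max(g_ℓ, 4), 3ℓ + 4)` used here, which is the price of
the uniform argument ("we will not be able to get any bound on `g`, but of course it is always possible
to do so").

## The argument (HL, loc. cit., along a Poincaré decomposition)

`Y ∼ ∏_ν X_ν^{n_ν}` (simple, nonzero, pairwise non-isogenous abelian factors; `k_ν = n_ν dim X_ν`,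
`g = Σ k_ν`, `ρ(Y) = Σ_ν ρ(X_ν^{n_ν})`, Cor. 2.3).  With `ν₀` of maximal `k_{ν₀} = K` the two parts are
`X_{ν₀}^{n_{ν₀}}` (dimension `K`) and `B = ∏_{ν ≠ ν₀} X_ν^{n_ν}` (dimension `S = g − K`), both abelian
varieties, `ρ(Y) = ρ(X_{ν₀}^{n_{ν₀}}) + ρ(B)`, `1 ≤ ρ ≤ dim²` for each.  `S = 0` is `r(Y) = 1`:
`ρ(Y) = g²` or `ρ(Y) ≤ C(g+1, 2) ≤ (g−ℓ−1)² + (ℓ+1)²` for `g ≥ 3ℓ + 4` (§7.2).  Otherwise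
`n = min(K, S) ≥ 1`, `m = max(K, S)`: `n ≥ ℓ + 1` would give `ρ(Y) ≤ n² + m² ≤ (ℓ+1)² + (g−ℓ−1)²`; so
`n ≤ ℓ`, and with `t' = ℓ − n + 1 ∈ [1, ℓ]` the `m`-dimensional part has
`(m−t')² + t'² < ρ_m < (m−t'+1)²`, inside the `t'`-th window of dimension `m ≥ g/2 ≥ g_ℓ` — excluded by
the hypothesis (`t' ≥ 2`) or by Thm. 1.1 (1) (`t' = 1`, `m ≥ 4`).

## Cor. 7.6 for every `n` and Thm. 7.4 as printed for every `ℓ` (§4–§5)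

The boxes need no induction: along the same decomposition, for `k ≥ 1` and `g ≥ (k+2)²`,
`(g−k)² < ρ(A) ≤ (g−k)² + k²` forces a CM elliptic factor `X_{ν₀} = E` with `n_{ν₀} = g − k`
(`IsIsogenous.exists_cm_factor_of_box_of_powers`: `S = 0` by §7.2; `S ≥ k+1` by `ρ ≤ K² + S²` or
`ρ ≤ K g`; `S = k` by Thm. 1.1 (1) for `X_{ν₀}^{n_{ν₀}}`; `1 ≤ S ≤ k−1` because an isotypic power has
`ρ = K²` or `ρ ≤ C(K+1, 2)`), hence `A ∼ E^{g−k} × A_k` with `Hom(E, A_k) = 0`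
(`IsAbelianVariety.exists_isIsogenous_ellipticPow_prod_of_box`, `…_mem_box_iff`) and
`R_g ∩ ((g−k)², (g−k)² + k²] = (g−k)² + R_k` (`picardNumbers_inter_Ioc_box`).  With the gaps this is
**Thm. 7.4 as printed, for every `ℓ ≥ 1`** (`picardNumbers_boxes`): for `g ≥ max(g'_ℓ, (ℓ+2)², 4)`,
`x ∈ R_g ∩ [(g−ℓ)² + 1, g²]` iff `x = g²` or `x = (g−k)² + y`, `1 ≤ k ≤ ℓ`, `y ∈ R_k`.

No definition, no named fact (net debt 0).

## References

* [HulekLaface2019PicardNumbersAV] K. Hulek, R. Laface, *On the Picard numbers of abelian varieties*,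
  Ann. Sc. Norm. Super. Pisa Cl. Sci. (5) XIX (2019) 1199–1224 (arXiv:1703.05882), Thm. 1.1, §2.1
  Cor. 2.3, §3.1 Prop. 3.1, §7.2 Thm. 7.4 and its proof, Remark 7.5.
* [Lange2023AbelianVarietiesComplex] H. Lange, *Abelian Varieties over the Complex Numbers*, Grundlehren
  Text Edition, Springer (2023), §2.4.4 Thm. 2.4.25 (Poincaré's complete reducibility theorem).
-/

open Module Matrix Function
open Complex (I)

namespace Literature.Geometry.Kaehler

namespace ComplexTorus

/-- The covering space `E ≅ ℝ^ι` of a complex torus is finite-dimensional over `ℂ`. [cite: Lange2023AbelianVarietiesComplex, §1.1.1] -/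
private theorem finiteDimensional_complex_of_period {ι : Type*} [Fintype ι] {E : Type*} [NormedAddCommGroup E]
    [NormedSpace ℂ E] (Φ : (ι → ℝ) ≃L[ℝ] E) : FiniteDimensional ℂ E := by
  haveI : FiniteDimensional ℝ E := LinearEquiv.finiteDimensional Φ.toLinearEquiv
  exact Module.Finite.of_restrictScalars_finite ℝ ℂ E

/-- `dim_ℂ (Eᵐ) = m · dim_ℂ E`. [folklore] -/
private theorem finrank_fin_fun (m : ℕ) (E : Type*) [NormedAddCommGroup E] [NormedSpace ℂ E]
    [FiniteDimensional ℂ E] : finrank ℂ (Fin m → E) = m * finrank ℂ E := by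
  rw [Module.finrank_pi_fintype, Finset.sum_const, Finset.card_univ, Fintype.card_fin, smul_eq_mul]

/-- `Σ_{i ∈ s} a_i² ≤ (Σ_{i ∈ s} a_i)²` for natural numbers. [folklore] -/
private theorem sum_sq_le_sq_sum {ρ : Type*} (s : Finset ρ) (a : ρ → ℕ) :
    ∑ i ∈ s, a i ^ 2 ≤ (∑ i ∈ s, a i) ^ 2 := by
  rw [sq (∑ i ∈ s, a i), Finset.sum_mul]
  exact Finset.sum_le_sum fun i hi ↦ by
    rw [sq]
    exact Nat.mul_le_mul_left _ (Finset.single_le_sum (fun j _ ↦ Nat.zero_le (a j)) hi)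

/-! ## §1 The arithmetic of the inductive step -/

section Arithmetic

/-- **"`n ≤ ℓ`, as `ρ(Y) > [g−(ℓ+1)]² + (ℓ+1)²`"**: `n² + (g−n)²` decreases on `a ≤ n ≤ g/2`, so
`n² + (g−n)² ≤ a² + (g−a)²`. [cite: HulekLaface2019PicardNumbersAV, §7.2 Thm. 7.4 (proof) and §3.1 Prop. 3.1 (proof)] -/
theorem sq_add_sq_le_of_le {a n g : ℕ} (ha : a ≤ n) (h2 : 2 * n ≤ g) :
    n ^ 2 + (g - n) ^ 2 ≤ a ^ 2 + (g - a) ^ 2 := by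
  obtain ⟨d, rfl⟩ : ∃ d, n = a + d := ⟨n - a, by omega⟩
  obtain ⟨c, rfl⟩ : ∃ c, g = 2 * (a + d) + c := ⟨g - 2 * (a + d), by omega⟩
  rw [show 2 * (a + d) + c - (a + d) = a + d + c from by omega,
    show 2 * (a + d) + c - a = a + 2 * d + c from by omega]
  nlinarith [Nat.zero_le (d * c), Nat.zero_le (d * d)]

/-- **The self-product bound below the `(ℓ+1)`-st window: `C(g+1, 2) ≤ (g−ℓ−1)² + (ℓ+1)²` for
`g ≥ 3ℓ + 4`** ("let `g` grow bigger so that the Picard numbers we wish to consider can only be realized by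
abelian varieties that are not a self-product of a simple abelian variety"). [cite: HulekLaface2019PicardNumbersAV, §7.2 Thm. 7.4 (proof) and condition (1)] -/
theorem choose_succ_le_gap {g ℓ : ℕ} (hg : 3 * ℓ + 4 ≤ g) :
    (g + 1).choose 2 ≤ (g - (ℓ + 1)) ^ 2 + (ℓ + 1) ^ 2 := by
  obtain ⟨u, rfl⟩ : ∃ u, g = u + (ℓ + 1) := ⟨g - (ℓ + 1), by omega⟩
  rw [Nat.add_sub_cancel, Nat.choose_two_right, show u + (ℓ + 1) + 1 - 1 = u + (ℓ + 1) from by omega]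
  apply Nat.div_le_of_le_mul
  have hu : 2 * ℓ + 3 ≤ u := by omega
  nlinarith [Nat.mul_le_mul_right u hu]

/-- **The heart of the inductive step** ("`ρ_{g−n} > [g−(ℓ+1)]² + (ℓ+1)² − n² > [(g−n)−(ℓ−n+1)]² + (ℓ−n+1)²`
… `ρ_{g−n} < (g−ℓ)² + 1 − ρ_n ≤ (g−ℓ)² = [(g−n)−(ℓ−n)]²`"): for `Y ∼ A_n × A_m`, `n + m = g`,
`1 ≤ n ≤ m`, `ρ(Y) = ρ_n + ρ_m`, `1 ≤ ρ_n ≤ n²`, `ρ_m ≤ m²` and `(g−ℓ−1)² + (ℓ+1)² < ρ(Y) < (g−ℓ)² + 1`: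
`n ≤ ℓ` and, with `t' = ℓ − n + 1 ∈ [1, ℓ]`, `(m−t')² + t'² < ρ_m < (m−t'+1)²`.
[cite: HulekLaface2019PicardNumbersAV, §7.2 Thm. 7.4 (proof, the inductive step)] -/
theorem gap_step_arith {g ℓ n m ρ ρn ρm : ℕ} (hgl : ℓ + 1 ≤ g) (hnm : n + m = g) (hle : n ≤ m)
    (hn : 1 ≤ n) (hρ : ρ = ρn + ρm) (hρn1 : 1 ≤ ρn) (hρn : ρn ≤ n ^ 2) (hρm : ρm ≤ m ^ 2)
    (h₁ : (g - (ℓ + 1)) ^ 2 + (ℓ + 1) ^ 2 < ρ) (h₂ : ρ < (g - ℓ) ^ 2 + 1) :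
    ∃ t, 1 ≤ t ∧ t ≤ ℓ ∧ (m - t) ^ 2 + t ^ 2 < ρm ∧ ρm < (m - t + 1) ^ 2 := by
  -- `n ≤ ℓ`
  have hnl : n ≤ ℓ := by
    by_contra hlt
    have h := sq_add_sq_le_of_le (show ℓ + 1 ≤ n by omega) (show 2 * n ≤ g by omega)
    rw [show g - n = m from by omega] at h
    omega
  obtain ⟨t, ht⟩ : ∃ t, n + t = ℓ + 1 := ⟨ℓ + 1 - n, by omega⟩
  refine ⟨t, by omega, by omega, ?_, ?_⟩
  · rw [show m - t = g - (ℓ + 1) from by omega]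
    have e : (ℓ + 1) ^ 2 = n ^ 2 + 2 * n * t + t ^ 2 := by rw [← ht]; ring
    omega
  · rw [show m - t + 1 = g - ℓ from by omega]
    omega

/-- **The inductive step for two parts** with the hypothesis on the `m`-dimensional part delivered by
the windows `2 ≤ t ≤ ℓ` in dimension `m ≥ g_ℓ` (`t' ≥ 2`) or by Thm. 1.1 (1) (`t' = 1`, `m ≥ 4`).
[cite: HulekLaface2019PicardNumbersAV, §7.2 Thm. 7.4 (proof) with Thm. 1.1 (1)] -/
theorem gap_step_of_parts {ℓ G g n m ρ ρn ρm : ℕ} (hG : 4 ≤ G)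
    (IH : ∀ m', G ≤ m' → ∀ t, 2 ≤ t → t ≤ ℓ → ∀ x ∈ picardNumbers m',
      ¬ ((m' - t) ^ 2 + t ^ 2 < x ∧ x < (m' - t + 1) ^ 2 + 1))
    (hg : 2 * G ≤ g) (hgl : ℓ + 1 ≤ g) (hnm : n + m = g) (hle : n ≤ m) (hn : 1 ≤ n)
    (hρ : ρ = ρn + ρm) (hρn1 : 1 ≤ ρn) (hρn : ρn ≤ n ^ 2) (hρm : ρm ≤ m ^ 2) (hmem : ρm ∈ picardNumbers m)
    (h₁ : (g - (ℓ + 1)) ^ 2 + (ℓ + 1) ^ 2 < ρ) (h₂ : ρ < (g - ℓ) ^ 2 + 1) : False := by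
  obtain ⟨t, ht1, htℓ, hlo, hhi⟩ := gap_step_arith hgl hnm hle hn hρ hρn1 hρn hρm h₁ h₂
  have hGm : G ≤ m := by omega
  rcases (show t = 1 ∨ 2 ≤ t by omega) with rfl | ht2
  · rw [show m - 1 + 1 = m from by omega] at hhi
    rw [one_pow] at hlo
    exact not_mem_picardNumbers_of_lt_of_lt (by omega) hlo hhi hmem
  · exact IH m hGm t ht2 htℓ ρm hmem ⟨hlo, by omega⟩

end Arithmetic

/-! ## §2 The inductive step along a Poincaré decomposition and for `R_g` -/

section Step

variable {ι : Type*} [Fintype ι] [DecidableEq ι] {E : Type*} [NormedAddCommGroup E] [NormedSpace ℂ E]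
  {ρ : Type*} [Fintype ρ] [DecidableEq ρ] {τ : ρ → Type*} [∀ ν, Fintype (τ ν)] [∀ ν, DecidableEq (τ ν)]
  [∀ ν, Nonempty (τ ν)]
  {G : ρ → Type*} [∀ ν, NormedAddCommGroup (G ν)] [∀ ν, NormedSpace ℂ (G ν)]
  (X : ∀ ν, (τ ν → ℝ) ≃L[ℝ] G ν) (n : ρ → ℕ)

/-- **The inductive step of Thm. 7.4 along a Poincaré decomposition, explicit genera**: if the windows
`((m−t)² + t², (m−t+1)² + 1)`, `2 ≤ t ≤ ℓ`, contain no Picard number of an `m`-dimensional abelian variety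
for every `m ≥ g₀ ≥ 4`, then for simple, nonzero, pairwise non-isogenous abelian varieties `X_ν`,
`n_ν ≥ 1` and `Y ∼ ∏_ν X_ν^{n_ν}` of dimension `g ≥ max(2 g₀, 3ℓ + 4)`,
`¬ ((g−ℓ−1)² + (ℓ+1)² < ρ(Y) < (g−ℓ)² + 1)`.  The two parts of the printed proof are the largest
isotypic factor `X_{ν₀}^{n_{ν₀}}` and the product of the others.
[cite: HulekLaface2019PicardNumbersAV, §7.2 Thm. 7.4 (proof)] [cite: Lange2023AbelianVarietiesComplex, §2.4.4 Thm. 2.4.25, Cor. 2.4.26] -/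
theorem IsIsogenous.not_gap_succ_of_powers {ℓ g₀ : ℕ} {A : (ι → ℝ) ≃L[ℝ] E} (hℓ : 1 ≤ ℓ) (hg₀ : 4 ≤ g₀)
    (IH : ∀ m, g₀ ≤ m → ∀ t, 2 ≤ t → t ≤ ℓ → ∀ x ∈ picardNumbers m,
      ¬ ((m - t) ^ 2 + t ^ 2 < x ∧ x < (m - t + 1) ^ 2 + 1))
    (hiso : IsIsogenous A (sigmaPiPeriod fun ν ↦ powPeriod (X ν) (n ν))) (hX : ∀ ν, IsSimple (X ν))
    (hA : ∀ ν, IsAbelianVariety (X ν)) (hXX : ∀ ν ν', ν ≠ ν' → ¬ IsIsogenous (X ν) (X ν'))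
    (hn : ∀ ν, 0 < n ν) (hg : 2 * g₀ ≤ finrank ℂ E) (hgℓ : 3 * ℓ + 4 ≤ finrank ℂ E)
    (h₁ : (finrank ℂ E - (ℓ + 1)) ^ 2 + (ℓ + 1) ^ 2 < finrank ℤ (neronSeveriGroup A))
    (h₂ : finrank ℤ (neronSeveriGroup A) < (finrank ℂ E - ℓ) ^ 2 + 1) : False := by
  haveI : ∀ ν, FiniteDimensional ℂ (G ν) := fun ν ↦ finiteDimensional_complex_of_period (X ν)
  have hgsum : finrank ℂ E = ∑ ν, n ν * finrank ℂ (G ν) := by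
    rw [hiso.finrank_eq _ _, finrank_powers_eq X n]
  have hρsum : finrank ℤ (neronSeveriGroup A) = ∑ ν, finrank ℤ (neronSeveriGroup (powPeriod (X ν) (n ν))) := by
    rw [hiso.finrank_neronSeveriGroup_eq _ _, finrank_neronSeveriGroup_powers X n hX hA hXX]
  have hk1 : ∀ ν, 1 ≤ n ν * finrank ℂ (G ν) := one_le_mul_finrank X n hn
  have hkd : ∀ ν, finrank ℂ (Fin (n ν) → G ν) = n ν * finrank ℂ (G ν) := fun ν ↦ finrank_fin_fun (n ν) (G ν)
  have hρ1 : ∀ ν, 1 ≤ finrank ℤ (neronSeveriGroup (powPeriod (X ν) (n ν))) := fun ν ↦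
    (((hA ν).pow (n ν)).finrank_neronSeveriGroup_facts (by rw [hkd]; exact hk1 ν)).1
  -- the largest isotypic factor `ν₀` (`K = k_{ν₀}`) and the product `B` of the others (dimension `S`)
  haveI : Nonempty ρ := by
    by_contra hne
    rw [not_nonempty_iff] at hne
    rw [Finset.univ_eq_empty, Finset.sum_empty] at hgsum
    omega
  obtain ⟨ν₀, -, hmax⟩ :=
    Finset.exists_max_image (Finset.univ : Finset ρ) (fun ν ↦ n ν * finrank ℂ (G ν)) Finset.univ_nonempty
  let e : ρ ≃ {ν // ν = ν₀} ⊕ {ν // ν ≠ ν₀} := (Equiv.sumCompl fun ν ↦ ν = ν₀).symm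
  letI : Unique {ν // ν = ν₀} := ⟨⟨⟨ν₀, rfl⟩⟩, fun ν ↦ Subtype.ext ν.2⟩
  have hsplit : ∀ f : ρ → ℕ, ∑ ν, f ν = f ν₀ + ∑ j : {ν // ν ≠ ν₀}, f j.1 := fun f ↦ by
    rw [← e.symm.sum_comp f, Fintype.sum_sum_type, Fintype.sum_unique]
    rfl
  have hB : IsAbelianVariety (sigmaPiPeriod fun j : {ν // ν ≠ ν₀} ↦ powPeriod (X j.1) (n j.1)) :=
    IsAbelianVariety.sigmaPi fun j ↦ (hA _).pow _
  have hρB : finrank ℤ (neronSeveriGroup (sigmaPiPeriod fun j : {ν // ν ≠ ν₀} ↦ powPeriod (X j.1) (n j.1))) =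
      ∑ j : {ν // ν ≠ ν₀}, finrank ℤ (neronSeveriGroup (powPeriod (X j.1) (n j.1))) :=
    finrank_neronSeveriGroup_powers (fun j : {ν // ν ≠ ν₀} ↦ X j.1) (fun j ↦ n j.1) (fun j ↦ hX _)
      (fun j ↦ hA _) (fun j j' hjj' ↦ hXX _ _ fun h ↦ hjj' (Subtype.ext h))
  have hdimB : finrank ℂ (∀ j : {ν // ν ≠ ν₀}, Fin (n j.1) → G j.1) =
      ∑ j : {ν // ν ≠ ν₀}, n j.1 * finrank ℂ (G j.1) :=
    finrank_powers_eq (fun j : {ν // ν ≠ ν₀} ↦ X j.1) (fun j ↦ n j.1)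
  -- the data of the two parts
  have hKS : n ν₀ * finrank ℂ (G ν₀) + ∑ j : {ν // ν ≠ ν₀}, n j.1 * finrank ℂ (G j.1) = finrank ℂ E := by
    rw [hgsum, hsplit]
  have hρKS : finrank ℤ (neronSeveriGroup A) = finrank ℤ (neronSeveriGroup (powPeriod (X ν₀) (n ν₀))) +
      ∑ j : {ν // ν ≠ ν₀}, finrank ℤ (neronSeveriGroup (powPeriod (X j.1) (n j.1))) := by
    rw [hρsum, hsplit]
  have hρ₀mem : finrank ℤ (neronSeveriGroup (powPeriod (X ν₀) (n ν₀))) ∈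
      picardNumbers (n ν₀ * finrank ℂ (G ν₀)) := by
    have h := ((hA ν₀).pow (n ν₀)).mem_picardNumbers
    rwa [hkd] at h
  have hρBmem : ∑ j : {ν // ν ≠ ν₀}, finrank ℤ (neronSeveriGroup (powPeriod (X j.1) (n j.1))) ∈
      picardNumbers (∑ j : {ν // ν ≠ ν₀}, n j.1 * finrank ℂ (G j.1)) := by
    have h := hB.mem_picardNumbers
    rwa [hdimB, hρB] at h
  have hρ₀le : finrank ℤ (neronSeveriGroup (powPeriod (X ν₀) (n ν₀))) ≤ (n ν₀ * finrank ℂ (G ν₀)) ^ 2 :=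
    finrank_neronSeveriGroup_powPeriod_le_sq (X ν₀) (n ν₀)
  have hρBle : ∑ j : {ν // ν ≠ ν₀}, finrank ℤ (neronSeveriGroup (powPeriod (X j.1) (n j.1))) ≤
      (∑ j : {ν // ν ≠ ν₀}, n j.1 * finrank ℂ (G j.1)) ^ 2 :=
    (Finset.sum_le_sum fun j _ ↦ finrank_neronSeveriGroup_powPeriod_le_sq (X j.1) (n j.1)).trans
      (sum_sq_le_sq_sum _ _)
  rcases Nat.eq_zero_or_pos (∑ j : {ν // ν ≠ ν₀}, n j.1 * finrank ℂ (G j.1)) with hS0 | hSpos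
  · -- `S = 0`: `r(Y) = 1`, `ρ = g²` or `ρ ≤ C(g+1, 2) ≤ (g−ℓ−1)² + (ℓ+1)²`
    haveI : IsEmpty {ν // ν ≠ ν₀} := ⟨fun j ↦ by
      have h := (Finset.sum_eq_zero_iff.1 hS0) j (Finset.mem_univ j)
      have h1 := hk1 j.1
      omega⟩
    have h1 : Fintype.card ρ = 1 :=
      Fintype.card_eq_one_iff.2 ⟨ν₀, fun ν ↦ by
        by_contra hν
        exact IsEmpty.false (⟨ν, hν⟩ : {ν // ν ≠ ν₀})⟩
    rcases hiso.finrank_neronSeveriGroup_eq_sq_or_le_choose_of_card_eq_one X n hX hA hn h1 with h | h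
    · have hsq : (finrank ℂ E - ℓ) ^ 2 + 1 ≤ finrank ℂ E ^ 2 := by
        have hle : (finrank ℂ E - ℓ) ^ 2 ≤ (finrank ℂ E - 1) ^ 2 :=
          Nat.pow_le_pow_left (by omega) 2
        have hlt : (finrank ℂ E - 1) ^ 2 < finrank ℂ E ^ 2 :=
          Nat.pow_lt_pow_left (by omega) two_ne_zero
        omega
      omega
    · exact absurd (h.trans (choose_succ_le_gap hgℓ)) (not_le.2 h₁)
  · -- two parts: the smaller one has dimension `n = min(K, S) ≥ 1`
    have hρB1 : 1 ≤ ∑ j : {ν // ν ≠ ν₀}, finrank ℤ (neronSeveriGroup (powPeriod (X j.1) (n j.1))) := by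
      obtain ⟨j, -, -⟩ := Finset.exists_ne_zero_of_sum_ne_zero hSpos.ne'
      exact (hρ1 j.1).trans
        (Finset.single_le_sum (f := fun j : {ν // ν ≠ ν₀} ↦ finrank ℤ (neronSeveriGroup (powPeriod (X j.1) (n j.1))))
          (fun _ _ ↦ Nat.zero_le _) (Finset.mem_univ j))
    rcases le_total (n ν₀ * finrank ℂ (G ν₀)) (∑ j : {ν // ν ≠ ν₀}, n j.1 * finrank ℂ (G j.1)) with hle | hle
    · -- `K ≤ S`: the hypothesis is applied to `B`
      exact gap_step_of_parts hg₀ IH hg (by omega) hKS hle (hk1 ν₀) hρKS (hρ1 ν₀) hρ₀le hρBle hρBmem h₁ h₂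
    · -- `S ≤ K`: the hypothesis is applied to `X_{ν₀}^{n_{ν₀}}`
      exact gap_step_of_parts hg₀ IH hg (by omega) ((add_comm _ _).trans hKS) hle hSpos
        ((hρKS.trans (add_comm _ _))) hρB1 hρBle hρ₀le hρ₀mem h₁ h₂

/-- **The inductive step on `R_g`**: if for all `m ≥ g₀ ≥ 4` and `2 ≤ t ≤ ℓ` the window
`((m−t)² + t², (m−t+1)² + 1)` misses `R_m`, then for all `g ≥ max(2 g₀, 3ℓ + 4)` the window
`((g−ℓ−1)² + (ℓ+1)², (g−ℓ)² + 1)` misses `R_g`. [cite: HulekLaface2019PicardNumbersAV, §7.2 Thm. 7.4 (proof, "we can find `g_{ℓ+1} ≥ g_ℓ`")] -/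
theorem picardNumbers_gap_step {ℓ g₀ g : ℕ} (hℓ : 1 ≤ ℓ) (hg₀ : 4 ≤ g₀)
    (IH : ∀ m, g₀ ≤ m → ∀ t, 2 ≤ t → t ≤ ℓ → ∀ x ∈ picardNumbers m,
      ¬ ((m - t) ^ 2 + t ^ 2 < x ∧ x < (m - t + 1) ^ 2 + 1))
    (hg : 2 * g₀ ≤ g) (hgℓ : 3 * ℓ + 4 ≤ g) {x : ℕ} (hx : x ∈ picardNumbers g)
    (h₁ : (g - (ℓ + 1)) ^ 2 + (ℓ + 1) ^ 2 < x) (h₂ : x < (g - ℓ) ^ 2 + 1) : False := by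
  obtain ⟨A, hAV, rfl⟩ := hx
  obtain ⟨ω, hω⟩ := hAV
  obtain ⟨r, V, hV, hVc, n, hVpos, hVs, hVab, hVV, hn, hiso⟩ := IsRiemannForm.exists_isIsogenous_powers_pos A hω
  haveI : ∀ ν, Nonempty (Fin (subRank (V ν))) := fun ν ↦ ⟨⟨0, hVpos ν⟩⟩
  have hgE : finrank ℂ (Fin g → ℂ) = g := Module.finrank_fin_fun ℂ
  exact hiso.not_gap_succ_of_powers _ n hℓ hg₀ IH hVs hVab hVV hn (by rw [hgE]; exact hg) (by rw [hgE]; exact hgℓ)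
    (by rw [hgE]; exact h₁) (by rw [hgE]; exact h₂)

end Step

/-! ## §3 Thm. 7.4 (gap form) for every `ℓ` -/

section Gaps

/-- **Hulek–Laface 2019, Thm. 7.4, gap form, for every `ℓ`**: "for every positive integer `ℓ` there
exists a genus `g_ℓ` such that" for all `g ≥ g_ℓ` there is no abelian variety of dimension `g` whose Picard
number `ρ` satisfies `(g−t)² + t² < ρ < (g−t+1)² + 1` for some `2 ≤ t ≤ ℓ` (the windows between the
boxes `R_{g,t} = (g−t)² + R_t` and `R_{g,t−1}`; the window `t = 1` is Thm. 1.1 (1), `g ≥ 4`).  By induction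
on `ℓ` with `g_{ℓ+1} = max(2 max(g_ℓ, 4), 3ℓ + 4)` (`picardNumbers_gap_step`).
[cite: HulekLaface2019PicardNumbersAV, §7.2 Thm. 7.4 and Remark 7.5 ("as `g → ∞` more and more gaps arise in `R_g`")] -/
theorem picardNumbers_gaps : ∀ ℓ : ℕ, ∃ g₀ : ℕ, ∀ g, g₀ ≤ g → ∀ t, 2 ≤ t → t ≤ ℓ →
    ∀ x ∈ picardNumbers g, ¬ ((g - t) ^ 2 + t ^ 2 < x ∧ x < (g - t + 1) ^ 2 + 1)
  | 0 => ⟨0, fun g _ t h2 h0 ↦ absurd h0 (by omega)⟩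
  | ℓ + 1 => by
      obtain ⟨g₀, hg₀⟩ := picardNumbers_gaps ℓ
      refine ⟨max (2 * max g₀ 4) (3 * ℓ + 4), fun g hg t ht2 htℓ x hx hgap ↦ ?_⟩
      have hg1 : 2 * max g₀ 4 ≤ g := le_trans (le_max_left _ _) hg
      have hg2 : 3 * ℓ + 4 ≤ g := le_trans (le_max_right _ _) hg
      rcases (show t ≤ ℓ ∨ t = ℓ + 1 by omega) with htℓ' | rfl
      · exact hg₀ g (le_trans (le_trans (le_max_left _ _) (Nat.le_mul_of_pos_left _ two_pos)) hg1) t ht2 htℓ' x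
          hx hgap
      · refine picardNumbers_gap_step (ℓ := ℓ) (g₀ := max g₀ 4) (by omega) (le_max_right _ _)
          (fun m hm t' ht2' htℓ'' y hy ↦ hg₀ m (le_trans (le_max_left _ _) hm) t' ht2' htℓ'' y hy) hg1 hg2 hx
          hgap.1 ?_
        have h := hgap.2
        rwa [show g - (ℓ + 1) + 1 = g - ℓ from by omega] at h

/-- **One window at a time**: for every `t ≥ 2` there is a genus `g_t` such that `R_g` misses
`((g−t)² + t², (g−t+1)² + 1)` for all `g ≥ g_t`. [cite: HulekLaface2019PicardNumbersAV, §7.2 Thm. 7.4] -/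
theorem exists_genus_not_mem_picardNumbers_gap (t : ℕ) (ht : 2 ≤ t) :
    ∃ g₀ : ℕ, ∀ g, g₀ ≤ g → ∀ x ∈ picardNumbers g, ¬ ((g - t) ^ 2 + t ^ 2 < x ∧ x < (g - t + 1) ^ 2 + 1) := by
  obtain ⟨g₀, h⟩ := picardNumbers_gaps t
  exact ⟨g₀, fun g hg x hx ↦ h g hg t ht le_rfl x hx⟩

variable {ι : Type*} [Fintype ι] [DecidableEq ι] {E : Type*} [NormedAddCommGroup E] [NormedSpace ℂ E]

/-- **Thm. 7.4 (gap form) for abelian varieties on an arbitrary period model**: for every `ℓ` there is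
`g_ℓ` such that every abelian variety `A = E/A(ℤ^ι)` of dimension `g = dim_ℂ E ≥ g_ℓ` has
`¬ ((g−t)² + t² < ρ(A) < (g−t+1)² + 1)` for all `2 ≤ t ≤ ℓ`. [cite: HulekLaface2019PicardNumbersAV, §7.2 Thm. 7.4] -/
theorem IsAbelianVariety.exists_genus_not_gap (ℓ : ℕ) :
    ∃ g₀ : ℕ, ∀ (A : (ι → ℝ) ≃L[ℝ] E), IsAbelianVariety A → g₀ ≤ finrank ℂ E → ∀ t, 2 ≤ t → t ≤ ℓ →
      ¬ ((finrank ℂ E - t) ^ 2 + t ^ 2 < finrank ℤ (neronSeveriGroup A) ∧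
        finrank ℤ (neronSeveriGroup A) < (finrank ℂ E - t + 1) ^ 2 + 1) := by
  obtain ⟨g₀, h⟩ := picardNumbers_gaps ℓ
  exact ⟨g₀, fun A hA hg t ht2 htℓ ↦ h _ hg t ht2 htℓ _ hA.mem_picardNumbers⟩

end Gaps

/-! ## §4 Cor. 7.6 for EVERY `n`: the box `((g−k)², (g−k)² + k²]` forces `A ∼ E^{g−k} × A_k`, `g ≥ (k+2)²`

The structure statement behind the boxes of Thm. 7.4, uniformly in `k ≥ 1` and with the explicit
genus `(k+2)²`, by the argument of §6–§7 of `ComplexTorusPicardNumberThirdGap.lean` along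
`A ∼ ∏_ν X_ν^{n_ν}` with `K = max_ν k_ν`, `S = g − K`: `S = 0` (`r = 1`, §7.2: `ρ ≤ C(g+1, 2) ≤ (g−k)²`
or `ρ = g²`); `S ≥ k + 1` (`ρ ≤ K² + S² ≤ (k+1)² + (g−k−1)² ≤ (g−k)²` when `K ≥ S`, `ρ ≤ K g ≤ (g−k)²`
when `2K < g`); `S = k` (Thm. 1.1 (1) for the big factor: `ρ(X_{ν₀}^{n_{ν₀}}) = K²`, a CM elliptic
power, or `ρ ≤ (K−1)² + 1 + k² ≤ (g−k)²`); `1 ≤ S ≤ k − 1` (the isotypic factor has `ρ = K²` — then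
`ρ ≥ K² + 1 > (g−k)² + k²` — or `ρ ≤ C(K+1, 2)` — then `ρ ≤ C(g, 2) + (k−1)² ≤ (g−k)²`).  No inductive
hypothesis is needed. [cite: HulekLaface2019PicardNumbersAV, §7.2 Cor. 7.6 and Thm. 7.4 (the boxes `R_{g,k}`)] -/

section BoxStructure

/-- `C(g+1, 2) ≤ (g−k)²` for `g ≥ 4k + 2`. [cite: HulekLaface2019PicardNumbersAV, §7.2 (condition (1))] -/
theorem choose_succ_le_sq_sub {g k : ℕ} (hg : 4 * k + 2 ≤ g) : (g + 1).choose 2 ≤ (g - k) ^ 2 := by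
  obtain ⟨u, rfl⟩ : ∃ u, g = u + k := ⟨g - k, by omega⟩
  rw [Nat.add_sub_cancel, Nat.choose_two_right, show u + k + 1 - 1 = u + k from by omega]
  apply Nat.div_le_of_le_mul
  have hu : 3 * k + 2 ≤ u := by omega
  nlinarith [Nat.mul_le_mul_right u hu]

/-- `C(K+1, 2) + (k−1)² ≤ (g−k)²` for `K + 1 ≤ g`, `g ≥ 4k`. [folklore] -/
private theorem choose_succ_add_sq_le_sq_sub {g k K : ℕ} (hk : 1 ≤ k) (hg : 4 * k ≤ g) (hK : K + 1 ≤ g) :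
    (K + 1).choose 2 + (k - 1) ^ 2 ≤ (g - k) ^ 2 := by
  have hmono : (K + 1).choose 2 ≤ g.choose 2 := Nat.choose_le_choose 2 hK
  obtain ⟨u, rfl⟩ : ∃ u, g = u + k := ⟨g - k, by omega⟩
  obtain ⟨j, rfl⟩ : ∃ j, k = j + 1 := ⟨k - 1, by omega⟩
  rw [Nat.add_sub_cancel, Nat.add_sub_cancel]
  have hdiv : (u + (j + 1)).choose 2 + j ^ 2 ≤ u ^ 2 := by
    rw [Nat.choose_two_right, show u + (j + 1) - 1 = u + j from by omega]
    have hu : 3 * j + 3 ≤ u := by omega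
    have h2 : (u + (j + 1)) * (u + j) + 2 * j ^ 2 ≤ 2 * u ^ 2 := by nlinarith [Nat.mul_le_mul_right u hu]
    omega
  omega

/-- `(g−k)² + k² < g²` for `1 ≤ k < g`, and `(g−k)² + k² ≤ g²` for `k ≤ g`. [folklore] -/
private theorem sq_sub_add_sq_le_sq {g k : ℕ} (hk : k ≤ g) : (g - k) ^ 2 + k ^ 2 ≤ g ^ 2 := by
  obtain ⟨u, rfl⟩ : ∃ u, g = u + k := ⟨g - k, by omega⟩
  rw [Nat.add_sub_cancel]
  nlinarith

/-- `(g−k)² + k² < g²` for `1 ≤ k < g`. [folklore] -/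
private theorem sq_sub_add_sq_lt_sq {g k : ℕ} (hk : 1 ≤ k) (hkg : k + 1 ≤ g) : (g - k) ^ 2 + k ^ 2 < g ^ 2 := by
  obtain ⟨u, rfl⟩ : ∃ u, g = u + k := ⟨g - k, by omega⟩
  rw [Nat.add_sub_cancel]
  have hu : 1 ≤ u := by omega
  nlinarith [Nat.mul_le_mul hu hk]

/-- `(g−1) g ≤ 2 (g−k)²` for `g ≥ 4k`, `k ≥ 1`. [folklore] -/
private theorem pred_mul_le_two_mul_sq_sub {g k : ℕ} (hk : 1 ≤ k) (hg : 4 * k ≤ g) :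
    (g - 1) * g ≤ 2 * (g - k) ^ 2 := by
  obtain ⟨u, rfl⟩ : ∃ u, g = u + k := ⟨g - k, by omega⟩
  obtain ⟨j, rfl⟩ : ∃ j, k = j + 1 := ⟨k - 1, by omega⟩
  rw [Nat.add_sub_cancel, show u + (j + 1) - 1 = u + j from by omega]
  have hu : 3 * j + 3 ≤ u := by omega
  nlinarith [Nat.mul_le_mul_right u hu]

/-- `(k+1)² + (g−k−1)² ≤ (g−k)²` for `g ≥ k² + 4k + 4`. [folklore] -/
private theorem sq_succ_add_sq_sub_le {g k : ℕ} (hg : k ^ 2 + 4 * k + 4 ≤ g) :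
    (k + 1) ^ 2 + (g - (k + 1)) ^ 2 ≤ (g - k) ^ 2 := by
  obtain ⟨u, rfl⟩ : ∃ u, g = u + (k + 1) := ⟨g - (k + 1), by omega⟩
  rw [Nat.add_sub_cancel, show u + (k + 1) - k = u + 1 from by omega]
  nlinarith

/-- `(K−1)² + 1 + k² ≤ K²` for `2K ≥ k² + 2`, `K ≥ 1`. [folklore] -/
private theorem sq_pred_add_one_add_sq_le {K k : ℕ} (hK : 1 ≤ K) (h : k ^ 2 + 2 ≤ 2 * K) :
    (K - 1) ^ 2 + 1 + k ^ 2 ≤ K ^ 2 := by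
  obtain ⟨u, rfl⟩ : ∃ u, K = u + 1 := ⟨K - 1, by omega⟩
  rw [Nat.add_sub_cancel]
  nlinarith

/-- `(g−k)² + k² < K² + 1` for `K ≥ g − k + 1` and `k² ≤ 2 (g−k)`. [folklore] -/
private theorem sq_sub_add_sq_lt_sq_succ {g k K : ℕ} (hK : g - k + 1 ≤ K) (h : k ^ 2 ≤ 2 * (g - k)) :
    (g - k) ^ 2 + k ^ 2 < K ^ 2 + 1 := by
  have hle : (g - k + 1) ^ 2 ≤ K ^ 2 := Nat.pow_le_pow_left hK 2
  nlinarith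

variable {ι : Type*} [Fintype ι] [DecidableEq ι] {E : Type*} [NormedAddCommGroup E] [NormedSpace ℂ E]
  {ρ : Type*} [Fintype ρ] [DecidableEq ρ] {τ : ρ → Type*} [∀ ν, Fintype (τ ν)] [∀ ν, DecidableEq (τ ν)]
  [∀ ν, Nonempty (τ ν)]
  {G : ρ → Type*} [∀ ν, NormedAddCommGroup (G ν)] [∀ ν, NormedSpace ℂ (G ν)]
  (X : ∀ ν, (τ ν → ℝ) ≃L[ℝ] G ν) (n : ρ → ℕ)

/-- **Cor. 7.6 for every `n = k ≥ 1`, decomposition level, `g ≥ (k+2)²`**: for simple, nonzero,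
pairwise non-isogenous abelian varieties `X_ν`, `n_ν ≥ 1` and `A ∼ ∏_ν X_ν^{n_ν}` of dimension
`g ≥ (k+2)²` with `(g−k)² < ρ(A) ≤ (g−k)² + k²`, some `X_{ν₀}` is a CM elliptic curve with
`n_{ν₀} = g − k`. [cite: HulekLaface2019PicardNumbersAV, §7.2 Cor. 7.6 ("we can write `X ∼ E^t × A_{g−t}`")] -/
theorem IsIsogenous.exists_cm_factor_of_box_of_powers {k : ℕ} {A : (ι → ℝ) ≃L[ℝ] E} (hk : 1 ≤ k)
    (hiso : IsIsogenous A (sigmaPiPeriod fun ν ↦ powPeriod (X ν) (n ν))) (hX : ∀ ν, IsSimple (X ν))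
    (hA : ∀ ν, IsAbelianVariety (X ν)) (hXX : ∀ ν ν', ν ≠ ν' → ¬ IsIsogenous (X ν) (X ν'))
    (hn : ∀ ν, 0 < n ν) (hg : (k + 2) ^ 2 ≤ finrank ℂ E)
    (h₁ : (finrank ℂ E - k) ^ 2 < finrank ℤ (neronSeveriGroup A))
    (h₂ : finrank ℤ (neronSeveriGroup A) ≤ (finrank ℂ E - k) ^ 2 + k ^ 2) :
    ∃ ν₀, finrank ℂ (G ν₀) = 1 ∧ finrank ℚ (endAlgRat (X ν₀)) = 2 ∧ n ν₀ = finrank ℂ E - k := by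
  have hg' : k ^ 2 + 4 * k + 4 ≤ finrank ℂ E := by rw [show k ^ 2 + 4 * k + 4 = (k + 2) ^ 2 from by ring]; exact hg
  haveI : ∀ ν, FiniteDimensional ℂ (G ν) := fun ν ↦ finiteDimensional_complex_of_period (X ν)
  have hgsum : finrank ℂ E = ∑ ν, n ν * finrank ℂ (G ν) := by
    rw [hiso.finrank_eq _ _, finrank_powers_eq X n]
  have hρsum : finrank ℤ (neronSeveriGroup A) = ∑ ν, finrank ℤ (neronSeveriGroup (powPeriod (X ν) (n ν))) := by
    rw [hiso.finrank_neronSeveriGroup_eq _ _, finrank_neronSeveriGroup_powers X n hX hA hXX]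
  have hk1 : ∀ ν, 1 ≤ n ν * finrank ℂ (G ν) := one_le_mul_finrank X n hn
  have hkd : ∀ ν, finrank ℂ (Fin (n ν) → G ν) = n ν * finrank ℂ (G ν) := fun ν ↦ finrank_fin_fun (n ν) (G ν)
  have hρ1 : ∀ ν, 1 ≤ finrank ℤ (neronSeveriGroup (powPeriod (X ν) (n ν))) := fun ν ↦
    (((hA ν).pow (n ν)).finrank_neronSeveriGroup_facts (by rw [hkd]; exact hk1 ν)).1
  have hcmof : ∀ ν, 2 ≤ n ν * finrank ℂ (G ν) →
      finrank ℤ (neronSeveriGroup (powPeriod (X ν) (n ν))) = (n ν * finrank ℂ (G ν)) ^ 2 →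
      finrank ℂ (G ν) = 1 ∧ finrank ℚ (endAlgRat (X ν)) = 2 := fun ν hk2 heq ↦ by
    have hmax : finrank ℤ (neronSeveriGroup (powPeriod (X ν) (n ν))) = (finrank ℂ (Fin (n ν) → G ν)) ^ 2 := by
      rw [hkd, heq]
    obtain ⟨θ, hθ, hcm, hiso'⟩ :=
      (finrank_neronSeveriGroup_eq_sq_iff_exists_isIsogenous_ellipticPow_cm (powPeriod (X ν) (n ν))
        (by rw [hkd]; exact hk2)).1 hmax
    rw [hkd] at hiso'
    obtain ⟨hXE, -⟩ := (hX ν).isIsogenous_ellipticPeriod_of_pow (hn ν) (lt_of_lt_of_le two_pos hk2) hθ hiso'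
    exact ⟨by rw [hXE.finrank_eq _ _]; exact Module.finrank_self ℂ,
      by rw [hXE.finrank_endAlgRat_eq, finrank_endAlgRat_ellipticPeriod_eq_two_iff]; exact hcm⟩
  -- the largest isotypic factor `ν₀`, `K = k_{ν₀}`, `S = g − K`
  haveI : Nonempty ρ := by
    by_contra hne
    rw [not_nonempty_iff] at hne
    rw [Finset.univ_eq_empty, Finset.sum_empty] at hgsum
    omega
  obtain ⟨ν₀, -, hmax⟩ :=
    Finset.exists_max_image (Finset.univ : Finset ρ) (fun ν ↦ n ν * finrank ℂ (G ν)) Finset.univ_nonempty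
  have hgsplit : finrank ℂ E = n ν₀ * finrank ℂ (G ν₀) +
      ∑ ν ∈ Finset.univ.erase ν₀, n ν * finrank ℂ (G ν) := by
    rw [hgsum, ← Finset.add_sum_erase _ _ (Finset.mem_univ ν₀)]
  have hρsplit : finrank ℤ (neronSeveriGroup A) = finrank ℤ (neronSeveriGroup (powPeriod (X ν₀) (n ν₀))) +
      ∑ ν ∈ Finset.univ.erase ν₀, finrank ℤ (neronSeveriGroup (powPeriod (X ν) (n ν))) := by
    rw [hρsum, ← Finset.add_sum_erase _ _ (Finset.mem_univ ν₀)]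
  have hrest : ∑ ν ∈ Finset.univ.erase ν₀, finrank ℤ (neronSeveriGroup (powPeriod (X ν) (n ν))) ≤
      (∑ ν ∈ Finset.univ.erase ν₀, n ν * finrank ℂ (G ν)) ^ 2 :=
    (Finset.sum_le_sum fun ν _ ↦ finrank_neronSeveriGroup_powPeriod_le_sq (X ν) (n ν)).trans
      (sum_sq_le_sq_sum _ _)
  have hrest1 : 0 < ∑ ν ∈ Finset.univ.erase ν₀, n ν * finrank ℂ (G ν) →
      1 ≤ ∑ ν ∈ Finset.univ.erase ν₀, finrank ℤ (neronSeveriGroup (powPeriod (X ν) (n ν))) := fun hS ↦ by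
    obtain ⟨ν₁, hν₁, -⟩ := Finset.exists_ne_zero_of_sum_ne_zero hS.ne'
    exact (hρ1 ν₁).trans
      (Finset.single_le_sum (f := fun ν ↦ finrank ℤ (neronSeveriGroup (powPeriod (X ν) (n ν))))
        (fun ν _ ↦ Nat.zero_le _) hν₁)
  have hall : finrank ℤ (neronSeveriGroup A) ≤ n ν₀ * finrank ℂ (G ν₀) * finrank ℂ E := by
    rw [hρsum, hgsum, Finset.mul_sum]
    exact Finset.sum_le_sum fun ν _ ↦ (finrank_neronSeveriGroup_powPeriod_le_sq (X ν) (n ν)).trans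
      (by rw [sq]; exact Nat.mul_le_mul_right _ (hmax ν (Finset.mem_univ ν)))
  have hρ₀le : finrank ℤ (neronSeveriGroup (powPeriod (X ν₀) (n ν₀))) ≤ (n ν₀ * finrank ℂ (G ν₀)) ^ 2 :=
    finrank_neronSeveriGroup_powPeriod_le_sq (X ν₀) (n ν₀)
  have hAV₀ : IsAbelianVariety (powPeriod (X ν₀) (n ν₀)) := (hA ν₀).pow (n ν₀)
  have facts₀ := hAV₀.finrank_neronSeveriGroup_facts (by rw [hkd]; exact hk1 ν₀)
  rw [hkd ν₀] at facts₀
  obtain ⟨-, -, f4, -, -⟩ := facts₀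
  -- `K = k_{ν₀}`, `S = Σ_{ν ≠ ν₀} k_ν = g − K`
  rcases (show (∑ ν ∈ Finset.univ.erase ν₀, n ν * finrank ℂ (G ν)) = 0 ∨
      (1 ≤ (∑ ν ∈ Finset.univ.erase ν₀, n ν * finrank ℂ (G ν)) ∧ n ν₀ * finrank ℂ (G ν₀) + k + 1 ≤ finrank ℂ E) ∨ n ν₀ * finrank ℂ (G ν₀) + k = finrank ℂ E ∨
      (1 ≤ (∑ ν ∈ Finset.univ.erase ν₀, n ν * finrank ℂ (G ν)) ∧ finrank ℂ E + 1 ≤ n ν₀ * finrank ℂ (G ν₀) + k) by omega) with hS | ⟨hS, hK⟩ | hK | ⟨hS, hK⟩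
  · -- `S = 0`: `r = 1`
    exfalso
    have hempty : Finset.univ.erase ν₀ = (∅ : Finset ρ) :=
      Finset.eq_empty_iff_forall_notMem.2 fun ν hν ↦ by
        have h0 := Finset.sum_eq_zero_iff.1 hS ν hν
        have h1 := hk1 ν
        omega
    have h1 : Fintype.card ρ = 1 := by
      rw [← Finset.card_univ, ← Finset.insert_erase (Finset.mem_univ ν₀), hempty, Finset.insert_empty,
        Finset.card_singleton]
    rcases hiso.finrank_neronSeveriGroup_eq_sq_or_le_choose_of_card_eq_one X n hX hA hn h1 with h | h
    · have hlt := sq_sub_add_sq_lt_sq (g := finrank ℂ E) hk (by omega)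
      omega
    · exact absurd (h.trans (choose_succ_le_sq_sub (by omega))) (not_le.2 h₁)
  · -- `S ≥ k + 1`
    exfalso
    rcases Nat.lt_or_ge (2 * (n ν₀ * finrank ℂ (G ν₀))) (finrank ℂ E) with h2 | h2
    · -- `2K < g`: `ρ ≤ K g ≤ (g−k)²`
      have hKg : 2 * (n ν₀ * finrank ℂ (G ν₀) * finrank ℂ E) ≤ (finrank ℂ E - 1) * finrank ℂ E := by
        rw [← mul_assoc]; exact Nat.mul_le_mul_right _ (by omega)
      have hsq := pred_mul_le_two_mul_sq_sub (g := finrank ℂ E) hk (by omega)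
      omega
    · -- `2K ≥ g`: `ρ ≤ K² + S² ≤ (k+1)² + (g−k−1)² ≤ (g−k)²`
      have hconv := sq_add_sq_le_of_le (a := k + 1) (n := (∑ ν ∈ Finset.univ.erase ν₀, n ν * finrank ℂ (G ν))) (g := finrank ℂ E)
        (by omega) (by omega)
      rw [show finrank ℂ E - (∑ ν ∈ Finset.univ.erase ν₀, n ν * finrank ℂ (G ν)) = n ν₀ * finrank ℂ (G ν₀) from by omega] at hconv
      have hstep := sq_succ_add_sq_sub_le (g := finrank ℂ E) (k := k) hg'
      omega
  · -- `S = k`, `K = g − k`: Thm. 1.1 (1) for the big factor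
    have hSk : (∑ ν ∈ Finset.univ.erase ν₀, n ν * finrank ℂ (G ν)) = k := by omega
    rcases f4 (by omega) with hρ₀ | hρ₀
    · obtain ⟨hd, hcm⟩ := hcmof ν₀ (by omega) hρ₀
      refine ⟨ν₀, hd, hcm, ?_⟩
      rw [hd, mul_one] at hK
      omega
    · exfalso
      rw [hSk] at hrest
      have hstep := sq_pred_add_one_add_sq_le (K := n ν₀ * finrank ℂ (G ν₀)) (k := k) (by omega) (by omega)
      rw [show finrank ℂ E - k = n ν₀ * finrank ℂ (G ν₀) from by omega] at h₁
      omega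
  · -- `1 ≤ S ≤ k − 1`, `K ≥ g − k + 1`: the isotypic factor has `ρ = K²` or `ρ ≤ C(K+1, 2)`
    exfalso
    have hr1 := hrest1 (by omega)
    have hSle : (∑ ν ∈ Finset.univ.erase ν₀, n ν * finrank ℂ (G ν)) ^ 2 ≤ (k - 1) ^ 2 := Nat.pow_le_pow_left (by omega) 2
    rcases (IsIsogenous.refl (powPeriod (X ν₀) (n ν₀))).finrank_neronSeveriGroup_eq_sq_or_le_choose_of_pow
        (hX ν₀) hAV₀ (hn ν₀) with h | h
    · rw [hkd] at h
      have hlt := sq_sub_add_sq_lt_sq_succ (g := finrank ℂ E) (k := k) (K := n ν₀ * finrank ℂ (G ν₀)) (by omega) (by omega)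
      omega
    · rw [hkd] at h
      have hstep := choose_succ_add_sq_le_sq_sub (K := n ν₀ * finrank ℂ (G ν₀)) hk (by omega : 4 * k ≤ finrank ℂ E) (by omega)
      omega

variable {A : (ι → ℝ) ≃L[ℝ] E}

/-- **Cor. 7.6 for every `n = k ≥ 1`, hypothesis-free, `g ≥ (k+2)²`**: if `ρ(A) ∈ ((g−k)², (g−k)² + k²]`
then `A ∼ E^{g−k} × A_k` with `E` a CM elliptic curve, `A_k` an abelian variety of dimension `k`
and `Hom(E, A_k) = 0`. [cite: HulekLaface2019PicardNumbersAV, §7.2 Cor. 7.6] [cite: Lange2023AbelianVarietiesComplex, §2.4.4 Thm. 2.4.25] -/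
theorem IsAbelianVariety.exists_isIsogenous_ellipticPow_prod_of_box {k : ℕ} (hAV : IsAbelianVariety A)
    (hk : 1 ≤ k) (hg : (k + 2) ^ 2 ≤ finrank ℂ E) (h₁ : (finrank ℂ E - k) ^ 2 < finrank ℤ (neronSeveriGroup A))
    (h₂ : finrank ℤ (neronSeveriGroup A) ≤ (finrank ℂ E - k) ^ 2 + k ^ 2) :
    ∃ (θ : ℂ) (hθ : 0 < θ.im) (m : ℕ) (B : (Fin (2 * m) → ℝ) ≃L[ℝ] (Fin m → ℂ)),
      (∃ a b : ℚ, θ ^ 2 + a * θ + b = 0) ∧ m = k ∧ IsAbelianVariety B ∧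
        homRat (ellipticPeriod hθ.ne') B = ⊥ ∧
        IsIsogenous A (prodPeriod (powPeriod (ellipticPeriod hθ.ne') (finrank ℂ E - k)) B) := by
  obtain ⟨ω, hω⟩ := hAV
  obtain ⟨r, V, hV, hVc, n, hVpos, hVs, hVab, hVV, hn, hiso⟩ := IsRiemannForm.exists_isIsogenous_powers_pos A hω
  haveI : ∀ ν, Nonempty (Fin (subRank (V ν))) := fun ν ↦ ⟨⟨0, hVpos ν⟩⟩
  obtain ⟨y, hd, hcm, hny⟩ := hiso.exists_cm_factor_of_box_of_powers _ n hk hVs hVab hVV hn hg h₁ h₂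
  obtain ⟨θ, hθ, m, B, hcmθ, hm, hB, hHom, hAB⟩ :=
    hiso.exists_isIsogenous_ellipticPow_prod_of_cm_factor _ n hVs hVab hVV y hd hcm
  rw [hny] at hm hAB
  have hkg : k ≤ finrank ℂ E := le_trans (by nlinarith) hg
  exact ⟨θ, hθ, m, B, hcmθ, by omega, hB, hHom, hAB⟩

/-- **Cor. 7.6 ⟺, every `k ≥ 1`, `g ≥ (k+2)²`: `ρ(A) ∈ ((g−k)², (g−k)² + k²]` iff
`A ∼ E^{g−k} × A_k` with `E` CM elliptic, `dim A_k = k`, `Hom(E, A_k) = 0`.** [cite: HulekLaface2019PicardNumbersAV, §7.2 Cor. 7.6] -/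
theorem IsAbelianVariety.finrank_neronSeveriGroup_mem_box_iff {k : ℕ} (hAV : IsAbelianVariety A)
    (hk : 1 ≤ k) (hg : (k + 2) ^ 2 ≤ finrank ℂ E) :
    ((finrank ℂ E - k) ^ 2 < finrank ℤ (neronSeveriGroup A) ∧
      finrank ℤ (neronSeveriGroup A) ≤ (finrank ℂ E - k) ^ 2 + k ^ 2) ↔
    ∃ (θ : ℂ) (hθ : 0 < θ.im) (B : (Fin (2 * k) → ℝ) ≃L[ℝ] (Fin k → ℂ)),
      (∃ a b : ℚ, θ ^ 2 + a * θ + b = 0) ∧ IsAbelianVariety B ∧ homRat (ellipticPeriod hθ.ne') B = ⊥ ∧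
        IsIsogenous A (prodPeriod (powPeriod (ellipticPeriod hθ.ne') (finrank ℂ E - k)) B) := by
  constructor
  · rintro ⟨h₁, h₂⟩
    obtain ⟨θ, hθ, m, B, hq, hm, hB, hHom, hAB⟩ := hAV.exists_isIsogenous_ellipticPow_prod_of_box hk hg h₁ h₂
    subst hm
    exact ⟨θ, hθ, B, hq, hB, hHom, hAB⟩
  · rintro ⟨θ, hθ, B, hq, hB, hHom, hAB⟩
    obtain ⟨hρ, hmem⟩ := hAB.finrank_neronSeveriGroup_eq_sq_add_of_shape (hθ := hθ) hq hB hHom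
    have hBk := picardNumbers_subset_Icc hk hmem
    rw [Set.mem_Icc] at hBk
    rw [hρ]
    exact ⟨by omega, by omega⟩

/-- **The box `R_{g,k}` as a set, every `k ≥ 1`, `g ≥ (k+2)²`: `R_g ∩ ((g−k)², (g−k)² + k²] = (g−k)² + R_k`.**
[cite: HulekLaface2019PicardNumbersAV, §7.2 Thm. 7.4 (the boxes `R_{g,k} = {(g−k)² + n | n ∈ R_k}`) and Cor. 7.6] -/
theorem picardNumbers_inter_Ioc_box {g k : ℕ} (hk : 1 ≤ k) (hg : (k + 2) ^ 2 ≤ g) :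
    picardNumbers g ∩ Set.Ioc ((g - k) ^ 2) ((g - k) ^ 2 + k ^ 2) = (fun x ↦ (g - k) ^ 2 + x) '' picardNumbers k := by
  have hkg : k ≤ g := le_trans (by nlinarith) hg
  ext x
  simp only [Set.mem_inter_iff, Set.mem_Ioc, Set.mem_image]
  constructor
  · rintro ⟨⟨A, hA, rfl⟩, h₁, h₂⟩
    obtain ⟨θ, hθ, m, B, hq, hm, hB, hHom, hAB⟩ := hA.exists_isIsogenous_ellipticPow_prod_of_box hk
      (by rw [Module.finrank_fin_fun]; exact hg) (by rw [Module.finrank_fin_fun]; exact h₁)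
      (by rw [Module.finrank_fin_fun]; exact h₂)
    subst hm
    obtain ⟨hρ, hmem⟩ := hAB.finrank_neronSeveriGroup_eq_sq_add_of_shape (hθ := hθ) hq hB hHom
    rw [Module.finrank_fin_fun] at hρ
    exact ⟨_, hmem, hρ.symm⟩
  · rintro ⟨y, hy, rfl⟩
    have hy' := picardNumbers_subset_Icc hk hy
    rw [Set.mem_Icc] at hy'
    have h := sq_add_mem_picardNumbers_of_mem hy (g - k)
    rw [show g - k + k = g from by omega] at h
    exact ⟨h, by omega, by omega⟩

end BoxStructure

/-! ## §5 Thm. 7.4 as printed, for every `ℓ`: `[(g−ℓ)² + 1, g²] ∩ R_g = ⊔_{k=0}^{ℓ} R_{g,k}` -/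

section Boxes

/-- **Hulek–Laface 2019, Thm. 7.4, as printed, for every `ℓ ≥ 1`**: "for every positive integer `ℓ` there
exists a genus `g_ℓ` such that `[(g−ℓ)² + 1, g²] ∩ R_g = ⊔_{k=0}^{ℓ} R_{g,k}` for all `g ≥ g_ℓ`", with
`R_{g,0} = {g²}` and `R_{g,k} = (g−k)² + R_k`: a number `x ∈ [(g−ℓ)² + 1, g²]` is the Picard number of
a `g`-dimensional abelian variety iff `x = g²` or `x = (g−k)² + y` with `1 ≤ k ≤ ℓ` and `y ∈ R_k`.
The genus is `max(g'_ℓ, (ℓ+2)², 4)` with `g'_ℓ` the genus of the gaps (`picardNumbers_gaps`).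
[cite: HulekLaface2019PicardNumbersAV, §7.2 Thm. 7.4 and Remark 7.5] -/
theorem picardNumbers_boxes {ℓ : ℕ} (hℓ : 1 ≤ ℓ) : ∃ g₀ : ℕ, ∀ g, g₀ ≤ g → ∀ x,
    (x ∈ picardNumbers g ∧ (g - ℓ) ^ 2 + 1 ≤ x ∧ x ≤ g ^ 2) ↔
      (x = g ^ 2 ∨ ∃ k, 1 ≤ k ∧ k ≤ ℓ ∧ ∃ y ∈ picardNumbers k, x = (g - k) ^ 2 + y) := by
  obtain ⟨g₁, hgap⟩ := picardNumbers_gaps ℓ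
  refine ⟨max g₁ (max ((ℓ + 2) ^ 2) 4), fun g hg x ↦ ?_⟩
  have hg₁ : g₁ ≤ g := le_trans (le_max_left _ _) hg
  have hgℓ : (ℓ + 2) ^ 2 ≤ g := le_trans (le_trans (le_max_left _ _) (le_max_right _ _)) hg
  have hg4 : 4 ≤ g := le_trans (le_trans (le_max_right _ _) (le_max_right _ _)) hg
  have hℓg : ℓ ≤ g := le_trans (by nlinarith) hgℓ
  constructor
  · rintro ⟨hx, hlo, hhi⟩
    rcases eq_or_lt_of_le hhi with h | hlt
    · exact Or.inl h
    · right
      -- the least `k` with `(g−k)² < x`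
      classical
      have hex : ∃ k, (g - k) ^ 2 < x := ⟨ℓ, by omega⟩
      refine ⟨Nat.find hex, ?_, Nat.find_min' hex (show (g - ℓ) ^ 2 < x by omega), ?_⟩
      · rcases Nat.eq_zero_or_pos (Nat.find hex) with h0 | h0
        · have h := Nat.find_spec hex
          rw [h0, Nat.sub_zero] at h
          omega
        · exact h0
      · have hk₀ : (g - Nat.find hex) ^ 2 < x := Nat.find_spec hex
        have hkℓ : Nat.find hex ≤ ℓ := Nat.find_min' hex (show (g - ℓ) ^ 2 < x by omega)
        have hk1 : 1 ≤ Nat.find hex := by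
          rcases Nat.eq_zero_or_pos (Nat.find hex) with h0 | h0
          · rw [h0, Nat.sub_zero] at hk₀
            omega
          · exact h0
        have hup : x ≤ (g - Nat.find hex + 1) ^ 2 := by
          have h := Nat.find_min hex (show Nat.find hex - 1 < Nat.find hex by omega)
          rw [show g - (Nat.find hex - 1) = g - Nat.find hex + 1 from by omega] at h
          omega
        rcases Nat.lt_or_ge ((g - Nat.find hex) ^ 2 + Nat.find hex ^ 2) x with hgapx | hbox
        · -- `x` in the `k`-th window: excluded
          exfalso
          rcases (show Nat.find hex = 1 ∨ 2 ≤ Nat.find hex by omega) with h1 | h2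
          · rw [h1, one_pow] at hgapx
            rw [h1, show g - 1 + 1 = g from by omega] at hup
            exact not_mem_picardNumbers_of_lt_of_lt hg4 hgapx (by omega) hx
          · exact hgap g hg₁ _ h2 hkℓ x hx ⟨hgapx, by omega⟩
        · -- `x` in the `k`-th box
          have hmem : x ∈ picardNumbers g ∩ Set.Ioc ((g - Nat.find hex) ^ 2) ((g - Nat.find hex) ^ 2 + Nat.find hex ^ 2) :=
            ⟨hx, hk₀, hbox⟩
          rw [picardNumbers_inter_Ioc_box hk1 (le_trans (Nat.pow_le_pow_left (by omega) 2) hgℓ)] at hmem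
          obtain ⟨y, hy, hyx⟩ := hmem
          exact ⟨y, hy, hyx.symm⟩
  · rintro (rfl | ⟨k, hk1, hkℓ, y, hy, rfl⟩)
    · have hmem := choose_add_sum_sq_mem_picardNumbers (S := Fin 1) ![g] 0
      simp only [Fin.sum_univ_one, Matrix.cons_val_zero] at hmem
      have c12 : Nat.choose 1 2 = 0 := by decide
      rw [c12, zero_add, zero_add] at hmem
      have hsq : (g - ℓ) ^ 2 ≤ (g - 1) ^ 2 := Nat.pow_le_pow_left (by omega) 2
      have hlt : (g - 1) ^ 2 < g ^ 2 := Nat.pow_lt_pow_left (by omega) two_ne_zero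
      exact ⟨hmem, by omega, le_rfl⟩
    · have hy' := picardNumbers_subset_Icc hk1 hy
      rw [Set.mem_Icc] at hy'
      have h := sq_add_mem_picardNumbers_of_mem hy (g - k)
      rw [show g - k + k = g from by omega] at h
      have hsq : (g - ℓ) ^ 2 ≤ (g - k) ^ 2 := Nat.pow_le_pow_left (by omega) 2
      have htop := sq_sub_add_sq_le_sq (show k ≤ g by omega)
      exact ⟨h, by omega, by omega⟩

end Boxes

end ComplexTorus

end Literature.Geometry.Kaehler
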